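import Literature.NumberTheory.LFunctions.Zhang2022.Section12Ded1217
import Literature.NumberTheory.LFunctions.Zhang2022.NumericsSection12ExactB

/-!
# Zhang (2022) §12: the leaf (12.16) from the two range claims of p. 73 — `Eq1216 ⇐ Low1522 ∧ Step12u049`

Topic `Literature/NumberTheory/LFunctions/Zhang2022` (Landau–Siegel audit tree; verdict-neutral).
Y. Zhang, *Discrete mean estimates and the Landau–Siegel zero*, arXiv:2211.02515v1 (2022)
[Zhang2022LandauSiegel]. **Status of the source: an unrefereed manuscript under adjudication**; everything in this
file is PROVED (theorems only; no new definitions, no new facts); nothing here is a claim about Theorems 1–2 of the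
source or about Landau–Siegel zeros.

**The printed sentence** (p. 73, tex L3710): "Thus, in a way similar to the evaluation of `Θ₁(𝐚₁₂,𝐚₂₅)`, we deduce
that `(1/2α)S₁(𝐚₁₅,𝐚₂₂) + (2/α)S₂(𝐚₁₅,𝐚₂₂) + (3/2α)S₃(𝐚₁₅,𝐚₂₂) = 𝔞(conj e₂* + ε/2)` (12.16)" — typed as the leaf
`Typed.Sec12C.Eq1216 c′` of `Skeleton.theorem1_of_leaves_v19` (hypothesis `h1216`).

**Result (kernel-checked).** `eq1216_of_low1522_step12u049 : Low1522 c′ → Step12u049 c′ → Eq1216 c′`: the leaf (12.16)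
FOLLOWS from the two p. 73 range claims that are already leaves of the skeleton (`hLow` "the first sum [`dr ≤ P″₁`]
contributes `o(α)`", `h049` "the sum over `P″₁ < dr < P₂` is … `𝓖_{jμ}` … `𝓦*_j` … `+ o(α)`"), by

1. the exact split `S_j(𝐚₁₅,𝐚₂₂) = S_j|_{dr ≤ P″₁} + S_j|_{P″₁ < dr < P₂}` (`Sec12D.Sj_a15_split`);
2. the weights `1/(2α), 2/α, 3/(2α)` of Proposition 7.1 against `α log P = π`: the weighted sum of the second main terms
   `main12u049int` of u049 is `𝔞 · e2starBarW(w_D)` (`weighted_main_eq`), where `w_D(j, z) = 𝓦*⁰_j(P^z)` and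
   `Numerics.e2starBarW` is the window functional of `NumericsSection12`;
3. the printed approximation "`𝓦*_j(P^z) ≃ −1 + (3−j)πi(z − 0.496)`" made quantitative: `‖𝓦*⁰_j(P^z) − wLin_j(z)‖ ≤ 10⁻⁵`
   on `[0.496, 0.5]` for `D ≥ D₀(c′)` (`(2β₆ − β_j)log P − (3−j)πi = m_j c′(α𝓛)πi`, `m_j = 5, −2, 3`; `log(P^z/P″₁) =
   (z − 0.496)log P − log(Dt₀)`; the same estimate as `Section12CWindows` for `𝓦⁰_j`);
4. the kernel enclosure of the six `𝔤𝔥`-window integrals in the linearised reading — the tree box `Numerics.E16l`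
   (`NumericsSection12ExactB.mem_E16l`), here compared against the SHARPER threshold `‖e2starBarW wLin − conj e₂*‖ <
   3.3·10⁻⁶` (`cert16l_sharp`, `decide +kernel`; value `3.228·10⁻⁶`, kit lineage j247240);
5. bookkeeping of the `ε₁ⱼ`-slack of u049 (`10⁻⁵·maj12u049int`) and of the linearisation error, each at most
   `10⁻⁵ · 0.055 · 𝔞` (`‖𝔤𝔥_{jμ}‖ ≤ 4.35, 1.68, 1.01, 1.01, 1.01, 1.01` on `[0, 0.004]`, `‖ι₃‖ ≤ 1.032`, `‖ι₄‖ ≤ 1.748`).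

Budget: `3.3·10⁻⁶ + 2·10⁻⁵·0.055 = 4.4·10⁻⁶ ≤ 5·10⁻⁶` = the typed "`ε/2`" of (12.16); the `o(α)` terms give the `+ ε`.
So the frontier hypothesis `h1216` of `theorem1_of_leaves_v19` is REFINABLE into `hLow`, `h049` (which are already
hypotheses): the open-leaf count drops by one. What is NOT proved here: `Low1522`, `Step12u049` themselves (Lemmas 8.2–8.4,
12.1 of the manuscript), nor anything about (12.15) (whose analogous reduction to (12.12)–(12.13) FAILS as typed by
`0.09·10⁻⁶`, cf. GAP row G-d38-2 and `Numerics.eq1215_lin`).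

## References

* Y. Zhang, arXiv:2211.02515v1 (2022), §12 p. 73, (12.16); §7 Prop. 7.1 p. 33; §8 (8.13)–(8.18) p. 48; §2 (2.10),
  (2.13), (2.22). [cite: Zhang2022LandauSiegel, §12 (12.16) p.73]
-/

noncomputable section

open Complex Real ComplexConjugate
open Literature.NumberTheory.LFunctions.Zhang2022
open Literature.NumberTheory.LFunctions.Zhang2022.Skeleton
open Literature.NumberTheory.LFunctions.Zhang2022.Typed.Sec12A
open Literature.NumberTheory.LFunctions.Zhang2022.Typed.Sec12C
open Literature.NumberTheory.LFunctions.Zhang2022.Numerics (wLin J6 J7 ghj6 ghj7 e2starBarW E16l mem_E16l)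
open Literature.Analysis.ValidatedNumerics.Numerics

namespace Literature.NumberTheory.LFunctions.Zhang2022.Sec12D

/-! ## The kernel enclosure of the `𝔤𝔥`-window value of `conj e₂*`, sharpened to `3.3·10⁻⁶` -/

section Certificate

/-- The sharper comparison on the tree box `E16l` of `e2starBarW wLin − conj e₂*`: `normSq < (3.3·10⁻⁶)²`
(value `(3.228·10⁻⁶)²`). [cite: Zhang2022LandauSiegel, §12 (12.16) p.73] -/
theorem cert16l_sharp : ((E16l).normSqFI.hi : ℚ) < (1089/100000000000000 : ℚ) * (SC : ℚ) := by
  decide +kernel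

/-- **`‖e2starBarW wLin − conj e₂*‖ < 3.3·10⁻⁶`**: the six linearised `𝔤𝔥`-window integrals of p. 73, weighted as in
(12.16), reproduce `conj e₂*` to within `3.3·10⁻⁶` (kernel; value `3.228·10⁻⁶`). [cite: Zhang2022LandauSiegel, §12 (12.16) p.73] -/
theorem norm_e2starBarW_lin_sub_lt : ‖e2starBarW wLin - conj e2star‖ < 33 / 10 ^ 7 := by
  have h := hi_bound (CB.mem_normSqFI mem_E16l) cert16l_sharp
  rw [Complex.normSq_eq_norm_sq] at h
  have h2 : ((1089/100000000000000 : ℚ) : ℝ) = (33 / 10 ^ 7) ^ 2 := by norm_num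
  rw [h2] at h
  exact lt_of_pow_lt_pow_left₀ 2 (by norm_num) h

end Certificate

/-! ## Sizes of the fixed profiles `𝔤𝔥_{jμ}` and of `ι₃, ι₄` -/

section Profiles

/-- `‖𝔤𝔥_{r₀,r₁,b,k}(x)‖ ≤ |r₀| + |r₁| + |b|π·0.004` for `|x| ≤ 0.004` (`|e^{−kπix}| = 1`).
[cite: Zhang2022LandauSiegel, §8 (8.13)–(8.18) p.48] -/
theorem norm_ghF_le_of_abs_le {r0 r1 b k : ℚ} {x : ℝ} (hx : |x| ≤ 0.004) :
    ‖ghF r0 r1 b k x‖ ≤ |(r0 : ℝ)| + |(r1 : ℝ)| + |(b : ℝ)| * π * 0.004 := by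
  have hE : ‖cexp (-((k : ℂ) * π * I * x))‖ = 1 := by
    rw [show (-((k : ℂ) * π * I * x)) = ((-((k : ℝ) * π * x) : ℝ) : ℂ) * I by push_cast; ring,
      Complex.norm_exp_ofReal_mul_I]
  have h1 : ‖(r0 : ℂ)‖ = |(r0 : ℝ)| := Complex.norm_ratCast r0
  have h2 : ‖(r1 : ℂ)‖ = |(r1 : ℝ)| := Complex.norm_ratCast r1
  have h3 : ‖(b : ℂ) * π * I * x‖ = |(b : ℝ)| * π * |x| := by
    rw [norm_mul, norm_mul, norm_mul, Complex.norm_I, mul_one, Complex.norm_ratCast, Complex.norm_real,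
      Complex.norm_real, Real.norm_eq_abs, Real.norm_eq_abs, abs_of_pos Real.pi_pos]
  have hb : 0 ≤ |(b : ℝ)| * π := by positivity
  unfold ghF
  calc ‖(r0 : ℂ) + ((r1 : ℂ) + b * π * I * x) * cexp (-(k * π * I * x))‖
      ≤ ‖(r0 : ℂ)‖ + ‖((r1 : ℂ) + b * π * I * x) * cexp (-(k * π * I * x))‖ := norm_add_le _ _
    _ = ‖(r0 : ℂ)‖ + ‖(r1 : ℂ) + b * π * I * x‖ := by rw [norm_mul, hE, mul_one]
    _ ≤ ‖(r0 : ℂ)‖ + (‖(r1 : ℂ)‖ + ‖(b : ℂ) * π * I * x‖) := by gcongr; exact norm_add_le _ _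
    _ = |(r0 : ℝ)| + |(r1 : ℝ)| + |(b : ℝ)| * π * |x| := by rw [h1, h2, h3]; ring
    _ ≤ |(r0 : ℝ)| + |(r1 : ℝ)| + |(b : ℝ)| * π * 0.004 := by nlinarith

/-- On the window `z ∈ [a, b] ⊆ [c − 0.004, c]` the argument `c − z` has `|c − z| ≤ 0.004`. [folklore] -/
private theorem abs_sub_le_of_mem {a b c z : ℝ} (hz : z ∈ Set.Icc a b) (ha : c - 0.004 ≤ a) (hb : b ≤ c) :
    |c - z| ≤ 0.004 := by
  obtain ⟨h1, h2⟩ := hz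
  rw [abs_le]; constructor <;> linarith

/-- `∫_a^b ‖f(c − z)‖dz ≤ (b − a)·C` from a pointwise bound on the window. [folklore] -/
private theorem integral_norm_le {f : ℝ → ℂ} (hf : Continuous f) {a b c C : ℝ} (hab : a ≤ b)
    (hC : ∀ z ∈ Set.Icc a b, ‖f (c - z)‖ ≤ C) :
    ∫ z in a..b, ‖f (c - z)‖ ≤ (b - a) * C := by
  have hi : IntervalIntegrable (fun z : ℝ => ‖f (c - z)‖) MeasureTheory.volume a b :=
    (Continuous.norm (hf.comp (by fun_prop))).intervalIntegrable _ _
  have h := intervalIntegral.integral_mono_on hab hi intervalIntegrable_const hC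
  rwa [intervalIntegral.integral_const, smul_eq_mul] at h

/-- `∫_{0.496}^{0.498}‖𝔤𝔥₁₆(0.498 − z)‖dz ≤ 0.002·4.35` (`𝔤𝔥₁₆ = 8/3 + (−5/3 − πiz/2)e^{−3πiz/2}`).
[cite: Zhang2022LandauSiegel, §8 (8.13) p.48] -/
theorem G6_one_le : ∫ z in (0.496:ℝ)..0.498, ‖ghj 1 6 (0.498 - z)‖ ≤ (0.498 - 0.496) * 4.35 := by
  refine integral_norm_le (continuous_ghF (8/3) (-5/3) (-1/2) (3/2)) (by norm_num) fun z hz => ?_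
  refine (norm_ghF_le_of_abs_le (abs_sub_le_of_mem hz (by norm_num) (by norm_num))).trans ?_
  have := Real.pi_lt_d2
  norm_num; nlinarith

/-- `∫_{0.496}^{0.498}‖𝔤𝔥₂₆(0.498 − z)‖dz ≤ 0.002·1.68`. [cite: Zhang2022LandauSiegel, §8 (8.14) p.48] -/
theorem G6_two_le : ∫ z in (0.496:ℝ)..0.498, ‖ghj 2 6 (0.498 - z)‖ ≤ (0.498 - 0.496) * 1.68 := by
  refine integral_norm_le (continuous_ghF (4/3) (-1/3) (1/2) (3/2)) (by norm_num) fun z hz => ?_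
  refine (norm_ghF_le_of_abs_le (abs_sub_le_of_mem hz (by norm_num) (by norm_num))).trans ?_
  have := Real.pi_lt_d2
  norm_num; nlinarith

/-- `∫_{0.496}^{0.498}‖𝔤𝔥₃₆(0.498 − z)‖dz ≤ 0.002·1.01`. [cite: Zhang2022LandauSiegel, §8 (8.15) p.48] -/
theorem G6_three_le : ∫ z in (0.496:ℝ)..0.498, ‖ghj 3 6 (0.498 - z)‖ ≤ (0.498 - 0.496) * 1.01 := by
  refine integral_norm_le (continuous_ghF (8/9) (1/9) (1/6) (3/2)) (by norm_num) fun z hz => ?_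
  refine (norm_ghF_le_of_abs_le (abs_sub_le_of_mem hz (by norm_num) (by norm_num))).trans ?_
  have := Real.pi_lt_d2
  norm_num; nlinarith

/-- `∫_{0.496}^{0.5}‖𝔤𝔥₁₇(0.5 − z)‖dz ≤ 0.004·1.01`. [cite: Zhang2022LandauSiegel, §8 (8.16) p.48] -/
theorem G7_one_le : ∫ z in (0.496:ℝ)..0.5, ‖ghj 1 7 (0.5 - z)‖ ≤ (0.5 - 0.496) * 1.01 := by
  refine integral_norm_le (continuous_ghF (24/25) (1/25) (1/10) (5/2)) (by norm_num) fun z hz => ?_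
  refine (norm_ghF_le_of_abs_le (abs_sub_le_of_mem hz (by norm_num) (by norm_num))).trans ?_
  have := Real.pi_lt_d2
  norm_num; nlinarith

/-- `∫_{0.496}^{0.5}‖𝔤𝔥₂₇(0.5 − z)‖dz ≤ 0.004·1.01`. [cite: Zhang2022LandauSiegel, §8 (8.17) p.48] -/
theorem G7_two_le : ∫ z in (0.496:ℝ)..0.5, ‖ghj 2 7 (0.5 - z)‖ ≤ (0.5 - 0.496) * 1.01 := by
  refine integral_norm_le (continuous_ghF (12/25) (13/25) (3/10) (5/2)) (by norm_num) fun z hz => ?_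
  refine (norm_ghF_le_of_abs_le (abs_sub_le_of_mem hz (by norm_num) (by norm_num))).trans ?_
  have := Real.pi_lt_d2
  norm_num; nlinarith

/-- `∫_{0.496}^{0.5}‖𝔤𝔥₃₇(0.5 − z)‖dz ≤ 0.004·1.01`. [cite: Zhang2022LandauSiegel, §8 (8.18) p.48] -/
theorem G7_three_le : ∫ z in (0.496:ℝ)..0.5, ‖ghj 3 7 (0.5 - z)‖ ≤ (0.5 - 0.496) * 1.01 := by
  refine integral_norm_le (continuous_ghF (8/25) (17/25) (-3/10) (5/2)) (by norm_num) fun z hz => ?_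
  refine (norm_ghF_le_of_abs_le (abs_sub_le_of_mem hz (by norm_num) (by norm_num))).trans ?_
  have := Real.pi_lt_d2
  norm_num; nlinarith

/-- `‖ι₃‖ ≤ 1.032` (`ι₃ = −1.00635 − 0.22789i`, (2.26)). [cite: Zhang2022LandauSiegel, §2 (2.26) p.10] -/
theorem norm_iota3_le_1032 : ‖iota3‖ ≤ 1.032 := by
  have h : ‖iota3‖ ^ 2 ≤ (1.032 : ℝ) ^ 2 := by
    rw [Complex.sq_norm, iota3]
    simp [Complex.normSq_apply]
    norm_num
  exact le_of_pow_le_pow_left₀ two_ne_zero (by norm_num) h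

/-- `‖ι₄‖ ≤ 1.748` (`ι₄ = −0.68738 + 1.60688i`, (2.26)). [cite: Zhang2022LandauSiegel, §2 (2.26) p.10] -/
theorem norm_iota4_le_1748 : ‖iota4‖ ≤ 1.748 := by
  have h : ‖iota4‖ ^ 2 ≤ (1.748 : ℝ) ^ 2 := by
    rw [Complex.sq_norm, iota4]
    simp [Complex.normSq_apply]
    norm_num
  exact le_of_pow_le_pow_left₀ two_ne_zero (by norm_num) h

/-- The three window norms `ν_j = ‖ι₃‖G6_j/((0.504)(0.498)) + ‖ι₄‖G7_j/((0.504)(0.5))`, `G6_j = ∫‖𝔤𝔥_{j6}(0.498−z)‖`,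
`G7_j = ∫‖𝔤𝔥_{j7}(0.5−z)‖`, are at most `0.064, 0.042, 0.037`. [cite: Zhang2022LandauSiegel, §12 (12.16) p.73] -/
theorem nu_le :
    ‖iota3‖ / (0.504 * 0.498) * (∫ z in (0.496:ℝ)..0.498, ‖ghj 1 6 (0.498 - z)‖) +
        ‖iota4‖ / (0.504 * 0.5) * (∫ z in (0.496:ℝ)..0.5, ‖ghj 1 7 (0.5 - z)‖) ≤ 0.064 ∧
    ‖iota3‖ / (0.504 * 0.498) * (∫ z in (0.496:ℝ)..0.498, ‖ghj 2 6 (0.498 - z)‖) +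
        ‖iota4‖ / (0.504 * 0.5) * (∫ z in (0.496:ℝ)..0.5, ‖ghj 2 7 (0.5 - z)‖) ≤ 0.042 ∧
    ‖iota3‖ / (0.504 * 0.498) * (∫ z in (0.496:ℝ)..0.498, ‖ghj 3 6 (0.498 - z)‖) +
        ‖iota4‖ / (0.504 * 0.5) * (∫ z in (0.496:ℝ)..0.5, ‖ghj 3 7 (0.5 - z)‖) ≤ 0.037 := by
  have h3 := norm_iota3_le_1032
  have h4 := norm_iota4_le_1748
  have h30 : 0 ≤ ‖iota3‖ / (0.504 * 0.498) := by positivity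
  have h40 : 0 ≤ ‖iota4‖ / (0.504 * 0.5) := by positivity
  have h3' : ‖iota3‖ / (0.504 * 0.498) ≤ 1.032 / (0.504 * 0.498) := by gcongr
  have h4' : ‖iota4‖ / (0.504 * 0.5) ≤ 1.748 / (0.504 * 0.5) := by gcongr
  have g0 : ∀ {a b : ℝ} {f : ℝ → ℂ}, a ≤ b → 0 ≤ ∫ z in a..b, ‖f z‖ := fun hab =>
    intervalIntegral.integral_nonneg hab fun z _ => norm_nonneg _
  refine ⟨?_, ?_, ?_⟩
  · have a := G6_one_le; have b := G7_one_le
    have a0 := g0 (f := fun z => ghj 1 6 (0.498 - z)) (by norm_num : (0.496:ℝ) ≤ 0.498)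
    have b0 := g0 (f := fun z => ghj 1 7 (0.5 - z)) (by norm_num : (0.496:ℝ) ≤ 0.5)
    nlinarith [mul_le_mul h3' a (by positivity) (by positivity), mul_le_mul h4' b (by positivity) (by positivity)]
  · have a := G6_two_le; have b := G7_two_le
    have a0 := g0 (f := fun z => ghj 2 6 (0.498 - z)) (by norm_num : (0.496:ℝ) ≤ 0.498)
    have b0 := g0 (f := fun z => ghj 2 7 (0.5 - z)) (by norm_num : (0.496:ℝ) ≤ 0.5)
    nlinarith [mul_le_mul h3' a (by positivity) (by positivity), mul_le_mul h4' b (by positivity) (by positivity)]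
  · have a := G6_three_le; have b := G7_three_le
    have a0 := g0 (f := fun z => ghj 3 6 (0.498 - z)) (by norm_num : (0.496:ℝ) ≤ 0.498)
    have b0 := g0 (f := fun z => ghj 3 7 (0.5 - z)) (by norm_num : (0.496:ℝ) ≤ 0.5)
    nlinarith [mul_le_mul h3' a (by positivity) (by positivity), mul_le_mul h4' b (by positivity) (by positivity)]

end Profiles

/-! ## The `D`-dependent weight `𝓦*⁰_j(P^z)` against its linearisation `wLin` -/

section Linearisation

/-- **The printed approximation "`𝓦*_j(P^z) ≃ −1 + (3−j)πi(z − 0.496)`" (p. 73), quantitative form.** If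
`B·log P − k = m c′(α𝓛)πi` (`|m| ≤ 8`, `‖k‖ ≤ 2π`) and `K(c′)𝓛⁻⁸ ≤ δ`, then on `0.496 ≤ z ≤ 0.5`
`‖(−1 + B log(P^z/P″₁)) − (−1 + k(z − 0.496))‖ ≤ δ` (`log(P^z/P″₁) = (z − 0.496)log P − log(Dt₀)`, `log(Dt₀) ≤ 520𝓛`,
`α𝓛 = π𝓛⁻⁸`). Same estimate as for `𝓦⁰_j` in `Section12CWindows`. [cite: Zhang2022LandauSiegel, §12 (12.16) p.73] -/
theorem lin_bound {c' : ℝ} {D : ℕ} (hL1 : 1 ≤ ell D) {δ : ℝ}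
    (hK : (0.004 * (8 * |c'| * π ^ 2) + 520 * (2 * π + 8 * |c'| * π ^ 2)) / ell D ^ 8 ≤ δ)
    {B kk : ℂ} {m : ℝ}
    (key : B * (Real.log (bigP D) : ℂ) - kk = ((m * c' * (alpha D * ell D) * π : ℝ) : ℂ) * I)
    (hm : |m| ≤ 8) (hkk : ‖kk‖ ≤ 2 * π) :
    ∀ z ∈ Set.Icc (0.496 : ℝ) 0.5,
      ‖(-1 + B * (Real.log (bigP D ^ z / P1pp D) : ℂ)) - (-1 + kk * ((z : ℂ) - 0.496))‖ ≤ δ := by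
  intro z hz
  have hLval : Real.log (bigP D) = ell D ^ 9 := by rw [bigP, Real.log_exp]
  have hℓ : 0 < ell D := by linarith
  have h8 : 0 < ell D ^ 8 := pow_pos hℓ 8
  have h9 : 0 < ell D ^ 9 := pow_pos hℓ 9
  have hαℓ : alpha D * ell D = π / ell D ^ 8 := alpha_mul_ell D hL1
  -- `‖B log P − k‖ ≤ 8|c′|π²𝓛⁻⁸`
  have hρ : ‖B * (Real.log (bigP D) : ℂ) - kk‖ ≤ 8 * |c'| * π ^ 2 / ell D ^ 8 := by
    rw [key, norm_mul, Complex.norm_I, mul_one, Complex.norm_real, Real.norm_eq_abs, hαℓ,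
      abs_mul, abs_mul, abs_mul, abs_div, abs_of_pos Real.pi_pos, abs_of_pos h8]
    have hx : 0 ≤ |c'| * (π / ell D ^ 8) * π := by positivity
    calc |m| * |c'| * (π / ell D ^ 8) * π = |m| * (|c'| * (π / ell D ^ 8) * π) := by ring
      _ ≤ 8 * (|c'| * (π / ell D ^ 8) * π) := mul_le_mul_of_nonneg_right hm hx
      _ = 8 * |c'| * π ^ 2 / ell D ^ 8 := by ring
  -- `‖B‖ log P ≤ 2π + 8|c′|π²`
  have hBL : ‖B‖ * ell D ^ 9 ≤ 2 * π + 8 * |c'| * π ^ 2 := by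
    have e : B * (Real.log (bigP D) : ℂ) = kk + (B * (Real.log (bigP D) : ℂ) - kk) := by ring
    have h1 : ‖B‖ * ell D ^ 9 = ‖B * (Real.log (bigP D) : ℂ)‖ := by
      rw [norm_mul, Complex.norm_real, Real.norm_eq_abs, hLval, abs_of_pos h9]
    rw [h1, e]
    calc ‖kk + (B * (Real.log (bigP D) : ℂ) - kk)‖
        ≤ ‖kk‖ + ‖B * (Real.log (bigP D) : ℂ) - kk‖ := norm_add_le _ _
      _ ≤ 2 * π + 8 * |c'| * π ^ 2 / ell D ^ 8 := add_le_add hkk hρ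
      _ ≤ 2 * π + 8 * |c'| * π ^ 2 := by
          have : 8 * |c'| * π ^ 2 / ell D ^ 8 ≤ 8 * |c'| * π ^ 2 :=
            div_le_self (by positivity) (one_le_pow₀ hL1)
          linarith
  -- `0 ≤ log(Dt₀) ≤ 520𝓛`
  have hlog : Real.log (t0 D) = 519 * Real.log (ell D) := by
    rw [t0, Real.log_pow]; push_cast; ring
  have hM0 : 0 ≤ ell D + Real.log (t0 D) := by
    have : 0 ≤ Real.log (ell D) := Real.log_nonneg hL1
    rw [hlog]; nlinarith
  have hM : ell D + Real.log (t0 D) ≤ 520 * ell D := by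
    have : Real.log (ell D) ≤ ell D := (Real.log_le_sub_one_of_pos hℓ).trans (by linarith)
    rw [hlog]; nlinarith
  have hB : ‖B‖ ≤ (2 * π + 8 * |c'| * π ^ 2) / ell D ^ 9 := by
    rw [le_div_iff₀ h9]; exact hBL
  have hBM : ‖B * ((ell D + Real.log (t0 D) : ℝ) : ℂ)‖ ≤ 520 * (2 * π + 8 * |c'| * π ^ 2) / ell D ^ 8 := by
    rw [norm_mul, Complex.norm_real, Real.norm_eq_abs, abs_of_nonneg hM0]
    calc ‖B‖ * (ell D + Real.log (t0 D))
        ≤ (2 * π + 8 * |c'| * π ^ 2) / ell D ^ 9 * (520 * ell D) :=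
          mul_le_mul hB hM hM0 (by positivity)
      _ = 520 * (2 * π + 8 * |c'| * π ^ 2) / ell D ^ 8 := by
          field_simp
  -- on the window `|z − 0.496| ≤ 0.004`
  obtain ⟨hz1, hz2⟩ := hz
  have hzabs : ‖((z : ℂ) - 0.496)‖ ≤ 0.004 := by
    have e : ((z : ℂ) - 0.496) = ((z - 0.496 : ℝ) : ℂ) := by push_cast; ring
    rw [e, Complex.norm_real, Real.norm_eq_abs, abs_le]
    constructor <;> linarith
  have e : (-1 + B * (Real.log (bigP D ^ z / P1pp D) : ℂ)) - (-1 + kk * ((z : ℂ) - 0.496))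
      = (B * (Real.log (bigP D) : ℂ) - kk) * ((z : ℂ) - 0.496)
        - B * ((ell D + Real.log (t0 D) : ℝ) : ℂ) := by
    rw [log_rpow_div_P1pp hL1 z, hlog]
    push_cast
    ring
  rw [e]
  calc ‖(B * (Real.log (bigP D) : ℂ) - kk) * ((z : ℂ) - 0.496) - B * ((ell D + Real.log (t0 D) : ℝ) : ℂ)‖
      ≤ ‖(B * (Real.log (bigP D) : ℂ) - kk) * ((z : ℂ) - 0.496)‖
          + ‖B * ((ell D + Real.log (t0 D) : ℝ) : ℂ)‖ := norm_sub_le _ _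
    _ ≤ (8 * |c'| * π ^ 2 / ell D ^ 8) * 0.004 + 520 * (2 * π + 8 * |c'| * π ^ 2) / ell D ^ 8 := by
        rw [norm_mul]
        exact add_le_add (mul_le_mul hρ hzabs (norm_nonneg _) (by positivity)) hBM
    _ = (0.004 * (8 * |c'| * π ^ 2) + 520 * (2 * π + 8 * |c'| * π ^ 2)) / ell D ^ 8 := by ring
    _ ≤ δ := hK

/-- **`‖𝓦*⁰_j(P^z) − wLin_j(z)‖ ≤ 10⁻⁵` on `[0.496, 0.5]` for `j = 1, 2, 3`, once `𝓛 ≥ 1` and `K(c′)𝓛⁻⁸ ≤ 10⁻⁵`**: the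
exact relations `(2β₆ − β_j)log P − (3−j)πi = m_j c′(α𝓛)πi` with `m_j = 5, −2, 3` ((2.13), (2.22), `α log P = π`).
[cite: Zhang2022LandauSiegel, §12 (12.16) p.73] -/
theorem frakwStar0_sub_wLin_le (c' : ℝ) {D : ℕ} (hL1 : 1 ≤ ell D)
    (hK : (0.004 * (8 * |c'| * π ^ 2) + 520 * (2 * π + 8 * |c'| * π ^ 2)) / ell D ^ 8 ≤ 1e-5) :
    ∀ j ∈ ({1, 2, 3} : Finset ℕ), ∀ z ∈ Set.Icc (0.496 : ℝ) 0.5,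
      ‖frakwStar0 c' D j (bigP D ^ z) - wLin j z‖ ≤ 1e-5 := by
  have hA : ((alpha D : ℝ) : ℂ) * (Real.log (bigP D) : ℝ) = (π : ℂ) := by
    rw [← Complex.ofReal_mul, alpha_mul_log_bigP D hL1]
  have hπ : ‖(π : ℂ)‖ = π := by rw [Complex.norm_real, Real.norm_eq_abs, abs_of_pos Real.pi_pos]
  intro j hj z hz
  simp only [Finset.mem_insert, Finset.mem_singleton] at hj
  rcases hj with rfl | rfl | rfl
  · -- j = 1: `(2β₆ − β₁)log P − 2πi = 5c′(α𝓛)πi`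
    have key : (2 * beta6 D - betaJ c' D 1) * (Real.log (bigP D) : ℂ)
        - 2 * π * I = (((5 : ℝ) * c' * (alpha D * ell D) * π : ℝ) : ℂ) * I := by
      norm_num only [betaJ, beta6, beta1, beta2, beta3]
      push_cast
      linear_combination (I * (2 + 5 * (c' : ℂ) * (alpha D : ℂ) * (ell D : ℂ))) * hA
    have h := lin_bound hL1 hK key (by norm_num) (by rw [norm_mul, norm_mul, Complex.norm_I, hπ]; norm_num) z hz
    have e : frakwStar0 c' D 1 (bigP D ^ z) - wLin 1 z =
        (-1 + (2 * beta6 D - betaJ c' D 1) * (Real.log (bigP D ^ z / P1pp D) : ℂ)) -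
          (-1 + 2 * π * I * ((z : ℂ) - 0.496)) := by
      unfold frakwStar0 Numerics.wLin; push_cast; ring
    rw [e]; exact h
  · -- j = 2: `(2β₆ − β₂)log P − πi = −2c′(α𝓛)πi`
    have key : (2 * beta6 D - betaJ c' D 2) * (Real.log (bigP D) : ℂ)
        - π * I = (((-2 : ℝ) * c' * (alpha D * ell D) * π : ℝ) : ℂ) * I := by
      norm_num only [betaJ, beta6, beta1, beta2, beta3]
      push_cast
      linear_combination (I * (1 - 2 * (c' : ℂ) * (alpha D : ℂ) * (ell D : ℂ))) * hA
    have h := lin_bound hL1 hK key (by norm_num) (by rw [norm_mul, Complex.norm_I, hπ]; linarith [Real.pi_pos]) z hz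
    have e : frakwStar0 c' D 2 (bigP D ^ z) - wLin 2 z =
        (-1 + (2 * beta6 D - betaJ c' D 2) * (Real.log (bigP D ^ z / P1pp D) : ℂ)) -
          (-1 + π * I * ((z : ℂ) - 0.496)) := by
      unfold frakwStar0 Numerics.wLin; push_cast; ring
    rw [e]; exact h
  · -- j = 3: `(2β₆ − β₃)log P − 0 = 3c′(α𝓛)πi`
    have key : (2 * beta6 D - betaJ c' D 3) * (Real.log (bigP D) : ℂ)
        - 0 = (((3 : ℝ) * c' * (alpha D * ell D) * π : ℝ) : ℂ) * I := by
      norm_num only [betaJ, beta6, beta1, beta2, beta3]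
      push_cast
      linear_combination (I * (3 * (c' : ℂ) * (alpha D : ℂ) * (ell D : ℂ))) * hA
    have h := lin_bound hL1 hK key (by norm_num) (by rw [norm_zero]; positivity) z hz
    have e : frakwStar0 c' D 3 (bigP D ^ z) - wLin 3 z =
        (-1 + (2 * beta6 D - betaJ c' D 3) * (Real.log (bigP D ^ z / P1pp D) : ℂ)) -
          (-1 + 0 * ((z : ℂ) - 0.496)) := by
      unfold frakwStar0 Numerics.wLin; push_cast; ring
    rw [e]; exact h

/-- Window perturbation: `‖∫_a^b f·w − ∫_a^b f·w′‖ ≤ δ∫_a^b‖f‖` when `‖w − w′‖ ≤ δ` on `[a, b]`. [folklore] -/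
private theorem norm_integral_mul_sub_le {a b δ : ℝ} (hab : a ≤ b) {f w w' : ℝ → ℂ} (hf : Continuous f)
    (hw : Continuous w) (hw' : Continuous w') (hδ : ∀ z ∈ Set.Icc a b, ‖w z - w' z‖ ≤ δ) :
    ‖(∫ z in a..b, f z * w z) - ∫ z in a..b, f z * w' z‖ ≤ δ * ∫ z in a..b, ‖f z‖ := by
  have hi1 : IntervalIntegrable (fun z : ℝ => f z * w z) MeasureTheory.volume a b :=
    Continuous.intervalIntegrable (by fun_prop) _ _
  have hi2 : IntervalIntegrable (fun z : ℝ => f z * w' z) MeasureTheory.volume a b :=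
    Continuous.intervalIntegrable (by fun_prop) _ _
  rw [← intervalIntegral.integral_sub hi1 hi2]
  have e : (fun z : ℝ => f z * w z - f z * w' z) = fun z : ℝ => f z * (w z - w' z) := by
    funext z; ring
  rw [e, ← intervalIntegral.integral_const_mul]
  refine intervalIntegral.norm_integral_le_of_norm_le hab ?_ ?_
  · refine Filter.Eventually.of_forall fun z hz => ?_
    rw [norm_mul, mul_comm]
    exact mul_le_mul_of_nonneg_right (hδ z (Set.Ioc_subset_Icc_self hz)) (norm_nonneg _)
  · exact (Continuous.norm hf).intervalIntegrable _ _ |>.const_mul δ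

/-- `𝓦*⁰_j(P^z)` is continuous in `z`. [cite: Zhang2022LandauSiegel, §12 (12.16) p.73] -/
theorem continuous_frakwStar0_rpow (c' : ℝ) {D : ℕ} (hL1 : 1 ≤ ell D) (j : ℕ) :
    Continuous fun z : ℝ => frakwStar0 c' D j (bigP D ^ z) := by
  have e : (fun z : ℝ => frakwStar0 c' D j (bigP D ^ z)) = fun z : ℝ =>
      -1 + (2 * beta6 D - betaJ c' D j) *
        ((((z - 0.496) * Real.log (bigP D) - ell D - 519 * Real.log (ell D) : ℝ)) : ℂ) := by
    funext z; unfold frakwStar0; rw [log_rpow_div_P1pp hL1 z]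
  rw [e]; fun_prop

end Linearisation

/-! ## The weighted main terms and slacks of u049 against `α log P = π` -/

section Weights

variable (c' : ℝ) {D : ℕ} [NeZero D] (χ : DirichletCharacter ℂ D)

/-- **The weighted sum of the second main terms of u049 is `𝔞 · e2starBarW(𝓦*⁰(P^·))`**: with the weights
`1/(2α), 2/α, 3/(2α)` of Proposition 7.1 and `α log P = π`, `Σ_j w_j·main12u049int_j = 𝔞·(1/(0.504π))Σ_j c_j
(ι₃J6_j/0.498 + ι₄J7_j/0.5)`, `c = (½, 2, 3/2)`. [cite: Zhang2022LandauSiegel, §12 (12.16) p.73] -/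
theorem weighted_main_eq (hD : 1 ≤ Real.log D) :
    (1 / (2 * alpha D) * main12u049int c' χ 1 + 2 / alpha D * main12u049int c' χ 2 +
        3 / (2 * alpha D) * main12u049int c' χ 3 : ℂ) =
      frakA χ * e2starBarW (fun j z => frakwStar0 c' D j (bigP D ^ z)) := by
  have hα0 : alpha D ≠ 0 := (alpha_pos_of_log hD).ne'
  have hα : (alpha D : ℂ) ≠ 0 := by exact_mod_cast hα0
  have hπ : (π : ℂ) ≠ 0 := by exact_mod_cast Real.pi_ne_zero
  have hlog : (Real.log (bigP D) : ℂ) = (π : ℂ) / (alpha D : ℂ) := by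
    have h := alpha_mul_logP (D := D) hD
    have h' : ((alpha D : ℝ) : ℂ) * (Real.log (bigP D) : ℂ) = (π : ℂ) := by exact_mod_cast h
    field_simp; rw [mul_comm]; exact h'
  have e61 : (∫ z in (0.496:ℝ)..0.498, ghj 1 6 (0.498 - z) * frakwStar0 c' D 1 (bigP D ^ z)) =
      J6 (fun j z => frakwStar0 c' D j (bigP D ^ z)) 1 := rfl
  have e62 : (∫ z in (0.496:ℝ)..0.498, ghj 2 6 (0.498 - z) * frakwStar0 c' D 2 (bigP D ^ z)) =
      J6 (fun j z => frakwStar0 c' D j (bigP D ^ z)) 2 := rfl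
  have e63 : (∫ z in (0.496:ℝ)..0.498, ghj 3 6 (0.498 - z) * frakwStar0 c' D 3 (bigP D ^ z)) =
      J6 (fun j z => frakwStar0 c' D j (bigP D ^ z)) 3 := rfl
  have e71 : (∫ z in (0.496:ℝ)..0.5, ghj 1 7 (0.5 - z) * frakwStar0 c' D 1 (bigP D ^ z)) =
      J7 (fun j z => frakwStar0 c' D j (bigP D ^ z)) 1 := rfl
  have e72 : (∫ z in (0.496:ℝ)..0.5, ghj 2 7 (0.5 - z) * frakwStar0 c' D 2 (bigP D ^ z)) =
      J7 (fun j z => frakwStar0 c' D j (bigP D ^ z)) 2 := rfl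
  have e73 : (∫ z in (0.496:ℝ)..0.5, ghj 3 7 (0.5 - z) * frakwStar0 c' D 3 (bigP D ^ z)) =
      J7 (fun j z => frakwStar0 c' D j (bigP D ^ z)) 3 := rfl
  simp only [main12u049int]
  rw [e61, e62, e63, e71, e72, e73, hlog]
  unfold e2starBarW
  push_cast
  field_simp

/-- **The weighted `ε₁ⱼ`-slack of u049 is at most `0.055·𝔞`**: `Σ_j w_j·maj12u049int_j = (𝔞/π)Σ_j c_jν_j ≤
(𝔞/π)(0.032 + 0.084 + 0.0555) ≤ 0.055·𝔞`. [cite: Zhang2022LandauSiegel, §12 (12.16) p.73] -/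
theorem weighted_maj_le (hD : 1 ≤ Real.log D) :
    1 / (2 * alpha D) * maj12u049int χ 1 + 2 / alpha D * maj12u049int χ 2 +
        3 / (2 * alpha D) * maj12u049int χ 3 ≤ frakA χ * 0.055 := by
  have hα0 : 0 < alpha D := alpha_pos_of_log hD
  have hπ : π ≠ 0 := Real.pi_ne_zero
  have hlog : Real.log (bigP D) = π / alpha D := by
    have h := alpha_mul_logP (D := D) hD
    field_simp; linarith
  have hA := frakA_nonneg χ
  obtain ⟨n1, n2, n3⟩ := nu_le
  set ν1 := ‖iota3‖ / (0.504 * 0.498) * (∫ z in (0.496:ℝ)..0.498, ‖ghj 1 6 (0.498 - z)‖) +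
        ‖iota4‖ / (0.504 * 0.5) * (∫ z in (0.496:ℝ)..0.5, ‖ghj 1 7 (0.5 - z)‖) with hν1
  set ν2 := ‖iota3‖ / (0.504 * 0.498) * (∫ z in (0.496:ℝ)..0.498, ‖ghj 2 6 (0.498 - z)‖) +
        ‖iota4‖ / (0.504 * 0.5) * (∫ z in (0.496:ℝ)..0.5, ‖ghj 2 7 (0.5 - z)‖) with hν2
  set ν3 := ‖iota3‖ / (0.504 * 0.498) * (∫ z in (0.496:ℝ)..0.498, ‖ghj 3 6 (0.498 - z)‖) +
        ‖iota4‖ / (0.504 * 0.5) * (∫ z in (0.496:ℝ)..0.5, ‖ghj 3 7 (0.5 - z)‖) with hν3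
  have e : 1 / (2 * alpha D) * maj12u049int χ 1 + 2 / alpha D * maj12u049int χ 2 +
        3 / (2 * alpha D) * maj12u049int χ 3 = frakA χ / π * (1 / 2 * ν1 + 2 * ν2 + 3 / 2 * ν3) := by
    simp only [maj12u049int, hν1, hν2, hν3, hlog]
    field_simp
  rw [e]
  have hπ3 : 3.14 < π := Real.pi_gt_d2
  have hsum : 1 / 2 * ν1 + 2 * ν2 + 3 / 2 * ν3 ≤ 0.1715 := by linarith
  have hAπ : 0 ≤ frakA χ / π := by positivity
  calc frakA χ / π * (1 / 2 * ν1 + 2 * ν2 + 3 / 2 * ν3) ≤ frakA χ / π * 0.1715 := by gcongr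
    _ = frakA χ * (0.1715 / π) := by ring
    _ ≤ frakA χ * 0.055 := by
        apply mul_le_mul_of_nonneg_left _ hA
        rw [div_le_iff₀ Real.pi_pos]; nlinarith

/-- **The linearisation error in the window functional**: if `‖w_j − wLin_j‖ ≤ δ` on `[0.496, 0.5]` (`j = 1,2,3`, all
weights continuous), then `‖e2starBarW w − e2starBarW wLin‖ ≤ δ·0.055`. [cite: Zhang2022LandauSiegel, §12 (12.16) p.73] -/
theorem e2starBarW_sub_lin_le {w : ℕ → ℝ → ℂ} {δ : ℝ} (hδ0 : 0 ≤ δ) (hw : ∀ j, Continuous (w j))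
    (hδ : ∀ j ∈ ({1, 2, 3} : Finset ℕ), ∀ z ∈ Set.Icc (0.496 : ℝ) 0.5, ‖w j z - wLin j z‖ ≤ δ) :
    ‖e2starBarW w - e2starBarW wLin‖ ≤ δ * 0.055 := by
  have hwl : ∀ j, Continuous (wLin j) := fun j => by unfold Numerics.wLin; fun_prop
  obtain ⟨n1, n2, n3⟩ := nu_le
  -- the six window differences
  have d6 : ∀ j ∈ ({1, 2, 3} : Finset ℕ), ‖J6 w j - J6 wLin j‖ ≤
      δ * ∫ z in (0.496:ℝ)..0.498, ‖ghj j 6 (0.498 - z)‖ := by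
    intro j hj
    have hδ' : ∀ z ∈ Set.Icc (0.496 : ℝ) 0.498, ‖w j z - wLin j z‖ ≤ δ :=
      fun z hz => hδ j hj z ⟨hz.1, hz.2.trans (by norm_num)⟩
    simp only [Finset.mem_insert, Finset.mem_singleton] at hj
    rcases hj with rfl | rfl | rfl
    · exact norm_integral_mul_sub_le (by norm_num) ((continuous_ghF (8/3) (-5/3) (-1/2) (3/2)).comp (by fun_prop))
        (hw 1) (hwl 1) hδ'
    · exact norm_integral_mul_sub_le (by norm_num) ((continuous_ghF (4/3) (-1/3) (1/2) (3/2)).comp (by fun_prop))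
        (hw 2) (hwl 2) hδ'
    · exact norm_integral_mul_sub_le (by norm_num) ((continuous_ghF (8/9) (1/9) (1/6) (3/2)).comp (by fun_prop))
        (hw 3) (hwl 3) hδ'
  have d7 : ∀ j ∈ ({1, 2, 3} : Finset ℕ), ‖J7 w j - J7 wLin j‖ ≤
      δ * ∫ z in (0.496:ℝ)..0.5, ‖ghj j 7 (0.5 - z)‖ := by
    intro j hj
    have hδ' : ∀ z ∈ Set.Icc (0.496 : ℝ) 0.5, ‖w j z - wLin j z‖ ≤ δ := fun z hz => hδ j hj z hz
    simp only [Finset.mem_insert, Finset.mem_singleton] at hj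
    rcases hj with rfl | rfl | rfl
    · exact norm_integral_mul_sub_le (by norm_num) ((continuous_ghF (24/25) (1/25) (1/10) (5/2)).comp (by fun_prop))
        (hw 1) (hwl 1) hδ'
    · exact norm_integral_mul_sub_le (by norm_num) ((continuous_ghF (12/25) (13/25) (3/10) (5/2)).comp (by fun_prop))
        (hw 2) (hwl 2) hδ'
    · exact norm_integral_mul_sub_le (by norm_num) ((continuous_ghF (8/25) (17/25) (-3/10) (5/2)).comp (by fun_prop))
        (hw 3) (hwl 3) hδ'
  have h61 := d6 1 (by simp); have h62 := d6 2 (by simp); have h63 := d6 3 (by simp)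
  have h71 := d7 1 (by simp); have h72 := d7 2 (by simp); have h73 := d7 3 (by simp)
  set G61 := ∫ z in (0.496:ℝ)..0.498, ‖ghj 1 6 (0.498 - z)‖
  set G62 := ∫ z in (0.496:ℝ)..0.498, ‖ghj 2 6 (0.498 - z)‖
  set G63 := ∫ z in (0.496:ℝ)..0.498, ‖ghj 3 6 (0.498 - z)‖
  set G71 := ∫ z in (0.496:ℝ)..0.5, ‖ghj 1 7 (0.5 - z)‖
  set G72 := ∫ z in (0.496:ℝ)..0.5, ‖ghj 2 7 (0.5 - z)‖
  set G73 := ∫ z in (0.496:ℝ)..0.5, ‖ghj 3 7 (0.5 - z)‖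
  -- the difference of the functionals
  have e : e2starBarW w - e2starBarW wLin = ((1 / (0.504 * π) : ℝ) : ℂ) *
      (1 / 2 * (iota3 * (J6 w 1 - J6 wLin 1) / 0.498 + iota4 * (J7 w 1 - J7 wLin 1) / 0.5)
        + 2 * (iota3 * (J6 w 2 - J6 wLin 2) / 0.498 + iota4 * (J7 w 2 - J7 wLin 2) / 0.5)
        + 3 / 2 * (iota3 * (J6 w 3 - J6 wLin 3) / 0.498 + iota4 * (J7 w 3 - J7 wLin 3) / 0.5)) := by
    unfold e2starBarW; ring
  have hπ := Real.pi_pos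
  have hc : ‖((1 / (0.504 * π) : ℝ) : ℂ)‖ = 1 / (0.504 * π) := by
    rw [Complex.norm_real, Real.norm_of_nonneg (by positivity)]
  -- per-`j` bracket bounds
  have br : ∀ {X6 X7 : ℂ} {g6 g7 : ℝ}, ‖X6‖ ≤ δ * g6 → ‖X7‖ ≤ δ * g7 →
      ‖iota3 * X6 / 0.498 + iota4 * X7 / 0.5‖ ≤
        δ * (0.504 * (‖iota3‖ / (0.504 * 0.498) * g6 + ‖iota4‖ / (0.504 * 0.5) * g7)) := by
    intro X6 X7 g6 g7 h6 h7
    have e1 : ‖iota3 * X6 / 0.498‖ = ‖iota3‖ * ‖X6‖ / 0.498 := by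
      rw [norm_div, norm_mul]; norm_num
    have e2 : ‖iota4 * X7 / 0.5‖ = ‖iota4‖ * ‖X7‖ / 0.5 := by
      rw [norm_div, norm_mul]; norm_num
    calc ‖iota3 * X6 / 0.498 + iota4 * X7 / 0.5‖ ≤ ‖iota3 * X6 / 0.498‖ + ‖iota4 * X7 / 0.5‖ := norm_add_le _ _
      _ = ‖iota3‖ * ‖X6‖ / 0.498 + ‖iota4‖ * ‖X7‖ / 0.5 := by rw [e1, e2]
      _ ≤ ‖iota3‖ * (δ * g6) / 0.498 + ‖iota4‖ * (δ * g7) / 0.5 := by gcongr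
      _ = δ * (0.504 * (‖iota3‖ / (0.504 * 0.498) * g6 + ‖iota4‖ / (0.504 * 0.5) * g7)) := by
          field_simp
  have b1 := br h61 h71
  have b2 := br h62 h72
  have b3 := br h63 h73
  rw [e, norm_mul, hc]
  have hn3 := norm_add₃_le
    (a := 1 / 2 * (iota3 * (J6 w 1 - J6 wLin 1) / 0.498 + iota4 * (J7 w 1 - J7 wLin 1) / 0.5))
    (b := 2 * (iota3 * (J6 w 2 - J6 wLin 2) / 0.498 + iota4 * (J7 w 2 - J7 wLin 2) / 0.5))
    (c := 3 / 2 * (iota3 * (J6 w 3 - J6 wLin 3) / 0.498 + iota4 * (J7 w 3 - J7 wLin 3) / 0.5))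
  rw [norm_mul, norm_mul, norm_mul] at hn3
  have k1 : ‖(1 / 2 : ℂ)‖ = 1 / 2 := by norm_num
  have k2 : ‖(2 : ℂ)‖ = 2 := by norm_num
  have k3 : ‖(3 / 2 : ℂ)‖ = 3 / 2 := by norm_num
  rw [k1, k2, k3] at hn3
  have hin : 0 < 1 / (0.504 * π) := by positivity
  calc 1 / (0.504 * π) * ‖1 / 2 * (iota3 * (J6 w 1 - J6 wLin 1) / 0.498 + iota4 * (J7 w 1 - J7 wLin 1) / 0.5)
        + 2 * (iota3 * (J6 w 2 - J6 wLin 2) / 0.498 + iota4 * (J7 w 2 - J7 wLin 2) / 0.5)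
        + 3 / 2 * (iota3 * (J6 w 3 - J6 wLin 3) / 0.498 + iota4 * (J7 w 3 - J7 wLin 3) / 0.5)‖
      ≤ 1 / (0.504 * π) * (1 / 2 * (δ * (0.504 * 0.064)) + 2 * (δ * (0.504 * 0.042))
          + 3 / 2 * (δ * (0.504 * 0.037))) := by
        apply mul_le_mul_of_nonneg_left _ hin.le
        refine hn3.trans ?_
        gcongr
        · exact b1.trans (by gcongr)
        · exact b2.trans (by gcongr)
        · exact b3.trans (by gcongr)
    _ = δ * (0.1715 / π) := by field_simp; ring
    _ ≤ δ * 0.055 := by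
        apply mul_le_mul_of_nonneg_left _ hδ0
        rw [div_le_iff₀ Real.pi_pos]; nlinarith [Real.pi_gt_d2]

/-- The norm of the weighted sum: `‖X/(2α) + 2Y/α + 3Z/(2α)‖ ≤ x/(2α) + 2y/α + 3z/(2α)` for `α > 0`.
[cite: Zhang2022LandauSiegel, §7 Prop. 7.1 p.33] -/
theorem norm_weighted_le {α : ℝ} (hα : 0 < α) {X Y Z : ℂ} {x y z : ℝ} (hX : ‖X‖ ≤ x) (hY : ‖Y‖ ≤ y)
    (hZ : ‖Z‖ ≤ z) :
    ‖(1 / (2 * α) * X + 2 / α * Y + 3 / (2 * α) * Z : ℂ)‖ ≤ 1 / (2 * α) * x + 2 / α * y + 3 / (2 * α) * z := by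
  have e1 : (1 / (2 * α) : ℂ) = ((1 / (2 * α) : ℝ) : ℂ) := by push_cast; ring
  have e2 : (2 / α : ℂ) = ((2 / α : ℝ) : ℂ) := by push_cast; ring
  have e3 : (3 / (2 * α) : ℂ) = ((3 / (2 * α) : ℝ) : ℂ) := by push_cast; ring
  have n1 : ‖((1 / (2 * α) : ℝ) : ℂ)‖ = 1 / (2 * α) := by
    rw [Complex.norm_real, Real.norm_of_nonneg (by positivity)]
  have n2 : ‖((2 / α : ℝ) : ℂ)‖ = 2 / α := by
    rw [Complex.norm_real, Real.norm_of_nonneg (by positivity)]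
  have n3 : ‖((3 / (2 * α) : ℝ) : ℂ)‖ = 3 / (2 * α) := by
    rw [Complex.norm_real, Real.norm_of_nonneg (by positivity)]
  rw [e1, e2, e3]
  calc ‖((1 / (2 * α) : ℝ) : ℂ) * X + ((2 / α : ℝ) : ℂ) * Y + ((3 / (2 * α) : ℝ) : ℂ) * Z‖
      ≤ ‖((1 / (2 * α) : ℝ) : ℂ) * X‖ + ‖((2 / α : ℝ) : ℂ) * Y‖ + ‖((3 / (2 * α) : ℝ) : ℂ) * Z‖ :=
        norm_add₃_le
    _ = 1 / (2 * α) * ‖X‖ + 2 / α * ‖Y‖ + 3 / (2 * α) * ‖Z‖ := by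
        rw [norm_mul, norm_mul, norm_mul, n1, n2, n3]
    _ ≤ 1 / (2 * α) * x + 2 / α * y + 3 / (2 * α) * z := by
        have : 0 < 1 / (2 * α) := by positivity
        have : 0 < 2 / α := by positivity
        have : 0 < 3 / (2 * α) := by positivity
        gcongr

end Weights

/-! ## (12.16) from the two range claims of p. 73 -/

section Edge

variable (c' : ℝ)

/-- **(12.16) ⇐ "first sum `o(α)`" + u049** (p. 73, tex L3688–3710: "Thus, in a way similar to the evaluation of
`Θ₁(𝐚₁₂,𝐚₂₅)`, we deduce that `(1/2α)S₁(𝐚₁₅,𝐚₂₂) + (2/α)S₂(𝐚₁₅,𝐚₂₂) + (3/2α)S₃(𝐚₁₅,𝐚₂₂) = 𝔞(conj e₂* + ε/2)`"):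
the leaf `Typed.Sec12C.Eq1216 c′` of `theorem1_of_leaves_v19` follows from the leaves `Low1522 c′` and `Step12u049 c′`
by the split `S_j = S_j|_{dr ≤ P″₁} + S_j|_{P″₁ < dr < P₂}`, the weights of Proposition 7.1 (`α log P = π`), the
linearisation `𝓦*⁰_j(P^z) = −1 + (3−j)πi(z − 0.496) + O(K(c′)𝓛⁻⁸)` and the kernel enclosure of the six `𝔤𝔥`-window
integrals (`‖e2starBarW wLin − conj e₂*‖ < 3.3·10⁻⁶`); the slacks add to `4.4·10⁻⁶·𝔞 ≤ (10⁻⁵/2)𝔞`.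
[cite: Zhang2022LandauSiegel, §12 (12.16) p.73] -/
theorem eq1216_of_low1522_step12u049 (hLow : Low1522 c') (h049 : Step12u049 c') : Eq1216 c' := by
  intro ε hε
  set η := ε / 8 with hη
  have hη0 : 0 < η := by positivity
  -- threshold for the linearisation of `𝓦*⁰_j(P^z)`
  obtain ⟨D₁, hD₁⟩ := ell_large (0.004 * (8 * |c'| * π ^ 2) + 520 * (2 * π + 8 * |c'| * π ^ 2)) 1e-5
    (by positivity) (by norm_num)
  have hlin : ForAllLarge fun D _ _ => 1 ≤ ell D ∧
      (0.004 * (8 * |c'| * π ^ 2) + 520 * (2 * π + 8 * |c'| * π ^ 2)) / ell D ^ 8 ≤ 1e-5 :=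
    ⟨D₁, fun D _ _ hD _ _ => hD₁ D hD⟩
  obtain ⟨D₀, hall⟩ := (((hLow η hη0).and (h049 η hη0)).and hlin).and (forAllLarge_log_ge 4)
  refine ⟨D₀, fun D _ χ hD hq hp hA a15 ha15 => ?_⟩
  obtain ⟨⟨⟨hLowD, h049D⟩, ⟨hL1, hK⟩⟩, hlog4⟩ := hall D χ hD hq hp
  have hD1 : 1 ≤ Real.log D := by linarith
  have hα := alpha_pos_of_log (D := D) hD1
  have hAf := frakA_nonneg χ
  -- names
  set S : ℕ → ℂ := fun j => Sj c' D j a15 (a22 χ) with hS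
  set B : ℕ → ℂ := fun j => SjOn c' D j a15 (a22 χ) (rngBot D) with hB
  set T : ℕ → ℂ := fun j => SjOn c' D j a15 (a22 χ) (rngTop D) with hT
  set m : ℕ → ℂ := fun j => main12u049int c' χ j with hm
  set M : ℕ → ℝ := fun j => maj12u049int χ j with hM
  set wD : ℕ → ℝ → ℂ := fun j z => frakwStar0 c' D j (bigP D ^ z) with hwD
  -- the range claims at `η`
  have hBj : ∀ j ∈ ({1, 2, 3} : Finset ℕ), ‖B j‖ ≤ η * alpha D := fun j hj => hLowD hA a15 ha15 j hj
  have hTj : ∀ j ∈ ({1, 2, 3} : Finset ℕ), ‖T j - m j‖ ≤ 1e-5 * M j + η * alpha D :=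
    fun j hj => (h049D hA a15 ha15 j hj).2
  -- the split and the decomposition `S_j = B_j + (T_j − m_j) + m_j`
  have hsplit : ∀ j, S j = B j + (T j - m j) + m j := fun j => by
    simp only [hS, hB, hT]; rw [Sj_a15_split c' χ hlog4 j a15]; ring
  have key : (1 / (2 * alpha D) * S 1 + 2 / alpha D * S 2 + 3 / (2 * alpha D) * S 3 : ℂ)
        - frakA χ * conj e2star
      = (1 / (2 * alpha D) * B 1 + 2 / alpha D * B 2 + 3 / (2 * alpha D) * B 3)
        + (1 / (2 * alpha D) * (T 1 - m 1) + 2 / alpha D * (T 2 - m 2) + 3 / (2 * alpha D) * (T 3 - m 3))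
        + ((1 / (2 * alpha D) * m 1 + 2 / alpha D * m 2 + 3 / (2 * alpha D) * m 3) - frakA χ * conj e2star) := by
    rw [hsplit 1, hsplit 2, hsplit 3]; ring
  -- the main terms: `Σ w_j m_j = 𝔞 · e2starBarW(w_D)`
  have hmain : (1 / (2 * alpha D) * m 1 + 2 / alpha D * m 2 + 3 / (2 * alpha D) * m 3 : ℂ) =
      frakA χ * e2starBarW wD := weighted_main_eq c' χ hD1
  -- the window functional against the kernel value
  have hwin : ‖e2starBarW wD - conj e2star‖ ≤ 1e-5 * 0.055 + 33 / 10 ^ 7 := by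
    have h1 : ‖e2starBarW wD - e2starBarW wLin‖ ≤ 1e-5 * 0.055 :=
      e2starBarW_sub_lin_le (by norm_num) (fun j => continuous_frakwStar0_rpow c' hL1 j)
        (frakwStar0_sub_wLin_le c' hL1 hK)
    have h2 := norm_e2starBarW_lin_sub_lt
    have e : e2starBarW wD - conj e2star =
        (e2starBarW wD - e2starBarW wLin) + (e2starBarW wLin - conj e2star) := by ring
    rw [e]
    exact (norm_add_le _ _).trans (by linarith)
  -- the three groups
  have g1 : ‖(1 / (2 * alpha D) * B 1 + 2 / alpha D * B 2 + 3 / (2 * alpha D) * B 3 : ℂ)‖ ≤ 4 * η := by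
    refine (norm_weighted_le hα (hBj 1 (by simp)) (hBj 2 (by simp)) (hBj 3 (by simp))).trans (le_of_eq ?_)
    field_simp; ring
  have g2 : ‖(1 / (2 * alpha D) * (T 1 - m 1) + 2 / alpha D * (T 2 - m 2) +
      3 / (2 * alpha D) * (T 3 - m 3) : ℂ)‖ ≤ 1e-5 * (frakA χ * 0.055) + 4 * η := by
    refine (norm_weighted_le hα (hTj 1 (by simp)) (hTj 2 (by simp)) (hTj 3 (by simp))).trans ?_
    have hw := weighted_maj_le χ hD1
    have e : 1 / (2 * alpha D) * (1e-5 * M 1 + η * alpha D) + 2 / alpha D * (1e-5 * M 2 + η * alpha D) +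
        3 / (2 * alpha D) * (1e-5 * M 3 + η * alpha D) =
        1e-5 * (1 / (2 * alpha D) * M 1 + 2 / alpha D * M 2 + 3 / (2 * alpha D) * M 3) + 4 * η := by
      field_simp; ring
    rw [e]
    have : (0 : ℝ) ≤ 1e-5 := by norm_num
    nlinarith
  have g3 : ‖(1 / (2 * alpha D) * m 1 + 2 / alpha D * m 2 + 3 / (2 * alpha D) * m 3 : ℂ)
      - frakA χ * conj e2star‖ ≤ frakA χ * (1e-5 * 0.055 + 33 / 10 ^ 7) := by
    rw [hmain, ← mul_sub, norm_mul, Complex.norm_real, Real.norm_of_nonneg hAf]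
    exact mul_le_mul_of_nonneg_left hwin hAf
  -- assembly
  rw [key]
  calc ‖(1 / (2 * alpha D) * B 1 + 2 / alpha D * B 2 + 3 / (2 * alpha D) * B 3)
        + (1 / (2 * alpha D) * (T 1 - m 1) + 2 / alpha D * (T 2 - m 2) + 3 / (2 * alpha D) * (T 3 - m 3))
        + ((1 / (2 * alpha D) * m 1 + 2 / alpha D * m 2 + 3 / (2 * alpha D) * m 3) - frakA χ * conj e2star)‖
      ≤ ‖(1 / (2 * alpha D) * B 1 + 2 / alpha D * B 2 + 3 / (2 * alpha D) * B 3 : ℂ)‖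
        + ‖(1 / (2 * alpha D) * (T 1 - m 1) + 2 / alpha D * (T 2 - m 2) + 3 / (2 * alpha D) * (T 3 - m 3) : ℂ)‖
        + ‖(1 / (2 * alpha D) * m 1 + 2 / alpha D * m 2 + 3 / (2 * alpha D) * m 3 : ℂ)
            - frakA χ * conj e2star‖ := norm_add₃_le
    _ ≤ 4 * η + (1e-5 * (frakA χ * 0.055) + 4 * η) + frakA χ * (1e-5 * 0.055 + 33 / 10 ^ 7) := by
        gcongr
    _ = frakA χ * (2e-5 * 0.055 + 33 / 10 ^ 7) + ε := by rw [hη]; ring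
    _ ≤ frakA χ * (1e-5 / 2) + ε := by
        have : (2e-5 * 0.055 + 33 / 10 ^ 7 : ℝ) ≤ 1e-5 / 2 := by norm_num
        nlinarith

end Edge

end Literature.NumberTheory.LFunctions.Zhang2022.Sec12D
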